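import Mathlib
import Literature.Analysis.FluidPDE.VectorCalculus

/-!
# Clause 13-R, route (ii′) item (a), part 2: NONLOCAL ADJOINT TOOLS — Fubini on `S × ℝ`, support-local integration by parts in `σ`,
# and the `σ`-by-parts of the Biot–Savart term `K₃•(Y_k′σ × (X_jτ − X_kσ))` with the core LOCALLY CONSTANT near the test field's support
# (crux `Clause13RNearStraightL`, stmt-NavierStokesRegularity-23612; line `rate_bordered_split`, STUB R `stub_rateRow13RFlat`)

Route `FilamentSkeletonRss`, Variant A1R.  Census item (a) of memo STRUCTURE-23612-conformal-cokernel-leafhand8-g1.md (the clause-level pairing identity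
`Σ_j ∫_{S_j} ⟪ψ_j, DT·Y_j⟫ = Σ_k ∫ ⟪(DT)^*ψ_k, Y_k⟫` behind the cokernel certificate `…Clause13RCokernelCertificate`) needs, besides the slip-term
identity (`…Clause13RSlipAdjoint`, part 1), three analytic moves for the NONLOCAL part of the closed form
`…Clause13LinearisedMapClauses.deriv_linearisedMap_inBall`
(`Σ_k (Γγ_k/4π) ∫ [(−3⟪ΔX, ΔY⟫K₅)•(X_k′σ × ΔX) + K₃•(X_k′σ × ΔY + Y_k′σ × ΔX)] dσ`, `ΔX = X_jτ − X_kσ`, `ΔY = Y_jτ − Y_kσ`):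

* §1 `integral_inner_deriv_eq_neg_of_support` — integration by parts on the line against a clamped `C¹` field when the weight is known to be
  differentiable ONLY ON THE SUPPORT of the field, with a continuous candidate derivative there (the Biot–Savart weight involves the core
  `Aa_k σ`, merely differentiable in the clause block, but CONSTANT on the double ball `‖X_kσ‖ ≤ 2R_b√(Γ log Γ)` by clause 13 — an open
  neighbourhood of the support of `Y_k`);
* §2 `setIntegral_integral_swap_of_continuous` — Fubini `∫_{τ∈S} ∫_σ g = ∫_σ ∫_{τ∈S} g` for a jointly continuous pairing density supported in
  `ℝ × K`, `S, K` compact (the balls are compact, `…Clause13RCokernelCertificate.isCompact_ball_of_cocompact`); `continuous_setIntegral_param` and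
  `setIntegral_inner_const` (pull the test vector out of the `τ`-integral) for the swapped weight `σ ↦ ∫_{S_j} H(τ,σ) dτ`;
* §3 the triple-product transposition `⟪φ, y′ × (p − x)⟫ = ⟪φ × (x − p), y′⟫` and **`integral_inner_kernel_cross_deriv_eq_neg`** — for a fixed
  station `p = X_jτ` and weight vector `φ = P_nψ_j(τ)`, a `C¹` axis `X = X_k`, a continuous positive core `a` equal to `a₀ > 0` on an open set
  `U ⊇ tsupport Y`: `∫ ⟪φ, ((‖p − Xσ‖² + aσ)^{3/2})⁻¹ • (Y′σ × (p − Xσ))⟫ dσ = −∫ ⟪G′σ, Yσ⟫ dσ` with the EXPLICIT adjoint kernel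
  `G′σ = (3⟪p − Xσ, X′σ⟫((‖p − Xσ‖² + a₀)^{5/2})⁻¹) • (φ × (Xσ − p)) + ((‖p − Xσ‖² + a₀)^{3/2})⁻¹ • (φ × X′σ)`
  (`hasDerivAt_kernelCross_of_mem`: the weight `σ ↦ K₃ • (φ × (Xσ − p))` has this derivative at every point of `U`).

Instantiation for the literal clause block: `p := X j τ`, `X := X k`, `a σ := κ·Aa k σ` (`κ = e^{−(1+γ_E−log 2)}`), `a₀ := κ·Aa k (c k)`,
`U := {σ : ‖X k σ‖ < 2R_b√(Γ log Γ)}` (open, contains the ball `S_k ⊇ tsupport Y_k`, and `Aa k = Aa k (c k)` on it by clause 13), `Y := Y k`.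
Hand `leafhand-ns-filamentskeletonrs-10-g0` (LAND-ONLY); `--supports stmt-NavierStokesRegularity-23612` helper.  HONEST FRAMING: one-dimensional
calculus for the clause-level pairing at a HYPOTHETICAL near-straight filament skeleton on the NEGATIVE side of a MODEL blow-up route; STUB R is NOT
proved here and nothing in this file bears on Navier–Stokes regularity or blow-up.
-/

noncomputable section

open MeasureTheory Filter Topology Set
open scoped RealInnerProductSpace InnerProductSpace
open Literature.Analysis.FluidPDE

namespace Summit.NavierStokesRegularity.NavierStokesRegularity.Theorems.Clause13RNonlocalAdjoint
set_option linter.dupNamespace false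

/-! ## §1 Integration by parts with support-local hypotheses -/

/-- **Integration by parts on the line, support-local form.**  `G` continuous, differentiable at every point of `tsupport Y` with a
derivative given there by a continuous `G′`; `Y ∈ C¹` with compact support: `∫ ⟪G, Y′⟫ = −∫ ⟪G′, Y⟫`. [folklore] -/
theorem integral_inner_deriv_eq_neg_of_support {G G' Y : ℝ → EuclideanSpace ℝ (Fin 3)}
    (hGc : Continuous G) (hG'c : Continuous G') (hG : ∀ σ ∈ tsupport Y, HasDerivAt G (G' σ) σ)
    (hY : ContDiff ℝ 1 Y) (hYc : HasCompactSupport Y) :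
    ∫ σ, ⟪G σ, deriv Y σ⟫ = - ∫ σ, ⟪G' σ, Y σ⟫ := by
  have hYd : Differentiable ℝ Y := hY.differentiable (by simp)
  have hYcont : Continuous Y := hY.continuous
  have hY'c : Continuous (deriv Y) := hY.continuous_deriv le_rfl
  have hY'cs : HasCompactSupport (deriv Y) := hYc.deriv
  have h1 : Integrable fun σ => ⟪G σ, deriv Y σ⟫ := by
    refine (hGc.inner hY'c).integrable_of_hasCompactSupport ?_
    refine HasCompactSupport.intro hY'cs fun σ hσ => ?_
    rw [image_eq_zero_of_notMem_tsupport hσ, inner_zero_right]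
  have h2 : Integrable fun σ => ⟪G' σ, Y σ⟫ := by
    refine (hG'c.inner hYcont).integrable_of_hasCompactSupport ?_
    refine HasCompactSupport.intro hYc fun σ hσ => ?_
    rw [image_eq_zero_of_notMem_tsupport hσ, inner_zero_right]
  have h3 : Integrable fun σ => ⟪G σ, Y σ⟫ := by
    refine (hGc.inner hYcont).integrable_of_hasCompactSupport ?_
    refine HasCompactSupport.intro hYc fun σ hσ => ?_
    rw [image_eq_zero_of_notMem_tsupport hσ, inner_zero_right]
  -- `h = ⟪G, Y⟫` has derivative `⟪G, Y′⟫ + ⟪G′, Y⟫` everywhere: on the support by the product rule, off it because `Y ≡ 0` nearby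
  have hderiv : ∀ σ, HasDerivAt (fun t => ⟪G t, Y t⟫) (⟪G σ, deriv Y σ⟫ + ⟪G' σ, Y σ⟫) σ := by
    intro σ
    by_cases hσ : σ ∈ tsupport Y
    · exact (hG σ hσ).inner ℝ ((hYd σ).hasDerivAt)
    · have hev : Y =ᶠ[𝓝 σ] 0 := notMem_tsupport_iff_eventuallyEq.1 hσ
      have hY0 : Y σ = 0 := hev.self_of_nhds
      have hY'0 : deriv Y σ = 0 := by
        rw [hev.deriv_eq]; exact deriv_const σ (0 : EuclideanSpace ℝ (Fin 3))
      have hh : (fun t => ⟪G t, Y t⟫) =ᶠ[𝓝 σ] fun _ => (0:ℝ) :=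
        hev.mono fun t ht => by
          show ⟪G t, Y t⟫ = (0:ℝ)
          rw [ht, Pi.zero_apply, inner_zero_right]
      rw [hY0, hY'0, inner_zero_right, inner_zero_right, add_zero]
      exact (hasDerivAt_const σ (0:ℝ)).congr_of_eventuallyEq hh
  have h12 : Integrable fun σ => ⟪G σ, deriv Y σ⟫ + ⟪G' σ, Y σ⟫ := h1.add h2
  have h0 := integral_eq_zero_of_hasDerivAt_of_integrable hderiv h12 h3
  rw [integral_add h1 h2] at h0
  linarith

/-! ## §2 Fubini on `S × ℝ` for continuous densities supported in `ℝ × K`; the swapped weight -/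

/-- **Fubini for the nonlocal pairing.**  A jointly continuous density `g(τ, σ)` that vanishes for `σ` outside a compact `K` can be integrated
over `τ ∈ S` (compact) and `σ ∈ ℝ` in either order. [folklore] -/
theorem setIntegral_integral_swap_of_continuous {S K : Set ℝ} (hS : IsCompact S) (hK : IsCompact K) {g : ℝ → ℝ → ℝ}
    (hg : Continuous (Function.uncurry g)) (hgK : ∀ τ σ, σ ∉ K → g τ σ = 0) :
    ∫ τ in S, ∫ σ, g τ σ = ∫ σ, ∫ τ in S, g τ σ := by
  have hint : Integrable (Function.uncurry g) ((volume.restrict S).prod volume) := by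
    rw [Measure.restrict_prod_eq_prod_univ]
    change IntegrableOn (Function.uncurry g) (S ×ˢ univ) (volume.prod volume)
    have hSK : IntegrableOn (Function.uncurry g) (S ×ˢ K) (volume.prod volume) :=
      (hg.continuousOn).integrableOn_compact (hS.prod hK)
    refine hSK.of_forall_sdiff_eq_zero (hS.measurableSet.prod MeasurableSet.univ) ?_
    rintro ⟨τ, σ⟩ ⟨hmem, hnot⟩
    have hσ : σ ∉ K := fun h => hnot ⟨hmem.1, h⟩
    exact hgK τ σ hσ
  exact integral_integral_swap hint

/-- The swapped weight `σ ↦ ∫_{τ∈S} H(τ, σ) dτ` of a jointly continuous kernel over a compact `S` is continuous. [folklore] -/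
theorem continuous_setIntegral_param {S : Set ℝ} (hS : IsCompact S) {H : ℝ → ℝ → EuclideanSpace ℝ (Fin 3)}
    (hH : Continuous (Function.uncurry H)) : Continuous fun σ => ∫ τ in S, H τ σ := by
  have h : Continuous (Function.uncurry fun σ τ => H τ σ) := hH.comp continuous_swap
  exact continuous_parametric_integral_of_continuous h hS

/-- Pull the test vector out of the `τ`-integral: `∫_{S} ⟪H τ, y⟫ dτ = ⟪∫_{S} H τ dτ, y⟫`. [folklore] -/
theorem setIntegral_inner_const {S : Set ℝ} {H : ℝ → EuclideanSpace ℝ (Fin 3)} (hH : IntegrableOn H S) (y : EuclideanSpace ℝ (Fin 3)) :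
    ∫ τ in S, ⟪H τ, y⟫ = ⟪∫ τ in S, H τ, y⟫ := by
  have h := integral_inner (𝕜 := ℝ) (μ := volume.restrict S) hH y
  rw [real_inner_comm, ← h]
  exact integral_congr_ae (Eventually.of_forall fun τ => real_inner_comm _ _)

/-! ## §3 The Biot–Savart `Y′`-term by parts in `σ`, core locally constant near the support -/

/-- Triple-product transposition: `⟪φ, y′ × (p − x)⟫ = ⟪φ × (x − p), y′⟫`. [folklore] -/
theorem inner_cross_sub_comm (φ y' p x : EuclideanSpace ℝ (Fin 3)) :
    ⟪φ, cross y' (p - x)⟫ = ⟪cross φ (x - p), y'⟫ := by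
  simp only [cross, cross_apply, PiLp.inner_apply, RCLike.inner_apply, conj_trivial, Fin.sum_univ_three,
    Matrix.cons_val_zero, Matrix.cons_val_one, Matrix.cons_val_two, Matrix.head_cons, Matrix.tail_cons,
    WithLp.ofLp_sub, Pi.sub_apply]
  ring

/-- … with the scalar kernel: `⟪φ, k • (y′ × (p − x))⟫ = ⟪k • (φ × (x − p)), y′⟫`. [folklore] -/
theorem inner_smul_cross_sub_comm (φ y' p x : EuclideanSpace ℝ (Fin 3)) (k : ℝ) :
    ⟪φ, k • cross y' (p - x)⟫ = ⟪k • cross φ (x - p), y'⟫ := by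
  rw [inner_smul_right, inner_smul_left, conj_trivial, inner_cross_sub_comm]

/-- The regularised distance `σ ↦ ‖p − X σ‖² + a₀` has derivative `−2⟪p − Xσ, X′σ⟫`. [folklore] -/
theorem hasDerivAt_normSq_sub_add {X : ℝ → EuclideanSpace ℝ (Fin 3)} (hX : ContDiff ℝ 1 X) (p : EuclideanSpace ℝ (Fin 3)) (a₀ σ : ℝ) :
    HasDerivAt (fun σ => ‖p - X σ‖ ^ 2 + a₀) (-(2 * ⟪p - X σ, deriv X σ⟫)) σ := by
  have hXd : HasDerivAt X (deriv X σ) σ := ((hX.differentiable (by simp)) σ).hasDerivAt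
  have h1 : HasDerivAt (fun σ => p - X σ) (-deriv X σ) σ := hXd.const_sub p
  have h2 := h1.norm_sq
  have h3 := h2.add_const a₀
  refine (h3.congr_deriv ?_).congr_of_eventuallyEq (Eventually.of_forall fun _ => rfl)
  rw [inner_neg_right]; ring

/-- **Derivative of the constant-core weight** `G₀ σ = ((‖p − Xσ‖² + a₀)^{3/2})⁻¹ • (φ × (Xσ − p))` (`a₀ > 0`, `X ∈ C¹`):
`G₀′σ = (3⟪p − Xσ, X′σ⟫((‖p − Xσ‖² + a₀)^{5/2})⁻¹) • (φ × (Xσ − p)) + ((‖p − Xσ‖² + a₀)^{3/2})⁻¹ • (φ × X′σ)`. [folklore] -/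
theorem hasDerivAt_kernelCross_const {X : ℝ → EuclideanSpace ℝ (Fin 3)} (hX : ContDiff ℝ 1 X) (p φ : EuclideanSpace ℝ (Fin 3))
    {a₀ : ℝ} (ha₀ : 0 < a₀) (σ : ℝ) :
    HasDerivAt (fun σ => ((‖p - X σ‖ ^ 2 + a₀) ^ (3 / 2 : ℝ))⁻¹ • cross φ (X σ - p))
      ((3 * ⟪p - X σ, deriv X σ⟫ * ((‖p - X σ‖ ^ 2 + a₀) ^ (5 / 2 : ℝ))⁻¹) • cross φ (X σ - p)
        + ((‖p - X σ‖ ^ 2 + a₀) ^ (3 / 2 : ℝ))⁻¹ • cross φ (deriv X σ)) σ := by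
  have hpos : ∀ σ', 0 < ‖p - X σ'‖ ^ 2 + a₀ := fun σ' => by positivity
  -- the scalar kernel as a negative power
  have hfun : (fun σ' => ((‖p - X σ'‖ ^ 2 + a₀) ^ (3 / 2 : ℝ))⁻¹) = fun σ' => (‖p - X σ'‖ ^ 2 + a₀) ^ (-(3 / 2) : ℝ) := by
    funext σ'; rw [Real.rpow_neg (hpos σ').le]
  have hk : HasDerivAt (fun σ' => ((‖p - X σ'‖ ^ 2 + a₀) ^ (3 / 2 : ℝ))⁻¹)
      (3 * ⟪p - X σ, deriv X σ⟫ * ((‖p - X σ‖ ^ 2 + a₀) ^ (5 / 2 : ℝ))⁻¹) σ := by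
    rw [hfun]
    have h := (hasDerivAt_normSq_sub_add hX p a₀ σ).rpow_const (p := -(3 / 2)) (Or.inl (hpos σ).ne')
    refine h.congr_deriv ?_
    rw [show (-(3 / 2) : ℝ) - 1 = -(5 / 2) by norm_num, Real.rpow_neg (hpos σ).le]
    ring
  -- the cross factor
  have hXd : HasDerivAt X (deriv X σ) σ := ((hX.differentiable (by simp)) σ).hasDerivAt
  have hc0 := (crossCLM φ).hasFDerivAt.comp_hasDerivAt σ (hXd.sub_const p)
  have hc : HasDerivAt (fun σ' => cross φ (X σ' - p)) (cross φ (deriv X σ)) σ :=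
    hc0.congr_of_eventuallyEq (Eventually.of_forall fun _ => rfl)
  have h := hk.smul hc
  refine (h.congr_deriv ?_).congr_of_eventuallyEq (Eventually.of_forall fun _ => rfl)
  rw [add_comm]

/-- **Derivative of the actual weight at a point where the core is locally constant.**  If the continuous core `a` equals `a₀ > 0` on an open
set `U`, then at every `σ ∈ U` the weight `G σ = ((‖p − Xσ‖² + aσ)^{3/2})⁻¹ • (φ × (Xσ − p))` has the constant-core derivative. [folklore] -/
theorem hasDerivAt_kernelCross_of_mem {X : ℝ → EuclideanSpace ℝ (Fin 3)} (hX : ContDiff ℝ 1 X) (p φ : EuclideanSpace ℝ (Fin 3))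
    {a : ℝ → ℝ} {a₀ : ℝ} (ha₀ : 0 < a₀) {U : Set ℝ} (hU : IsOpen U) (haU : ∀ σ ∈ U, a σ = a₀) {σ : ℝ} (hσ : σ ∈ U) :
    HasDerivAt (fun σ => ((‖p - X σ‖ ^ 2 + a σ) ^ (3 / 2 : ℝ))⁻¹ • cross φ (X σ - p))
      ((3 * ⟪p - X σ, deriv X σ⟫ * ((‖p - X σ‖ ^ 2 + a₀) ^ (5 / 2 : ℝ))⁻¹) • cross φ (X σ - p)
        + ((‖p - X σ‖ ^ 2 + a₀) ^ (3 / 2 : ℝ))⁻¹ • cross φ (deriv X σ)) σ := by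
  have hev : (fun σ => ((‖p - X σ‖ ^ 2 + a σ) ^ (3 / 2 : ℝ))⁻¹ • cross φ (X σ - p))
      =ᶠ[𝓝 σ] fun σ => ((‖p - X σ‖ ^ 2 + a₀) ^ (3 / 2 : ℝ))⁻¹ • cross φ (X σ - p) :=
    Filter.eventually_of_mem (hU.mem_nhds hσ) fun σ' hσ' => by simp only [haU σ' hσ']
  exact (hasDerivAt_kernelCross_const hX p φ ha₀ σ).congr_of_eventuallyEq hev

/-- Continuity of the weight `G` for a continuous positive core. [folklore] -/
theorem continuous_kernelCross {X : ℝ → EuclideanSpace ℝ (Fin 3)} (hX : ContDiff ℝ 1 X) (p φ : EuclideanSpace ℝ (Fin 3))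
    {a : ℝ → ℝ} (hac : Continuous a) (hapos : ∀ σ, 0 < a σ) :
    Continuous fun σ => ((‖p - X σ‖ ^ 2 + a σ) ^ (3 / 2 : ℝ))⁻¹ • cross φ (X σ - p) := by
  have hXc : Continuous X := hX.continuous
  have hs : Continuous fun σ => ‖p - X σ‖ ^ 2 + a σ := ((continuous_const.sub hXc).norm.pow 2).add hac
  have hpos : ∀ σ, 0 < ‖p - X σ‖ ^ 2 + a σ := fun σ => by have := hapos σ; positivity
  have hk : Continuous fun σ => ((‖p - X σ‖ ^ 2 + a σ) ^ (3 / 2 : ℝ))⁻¹ :=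
    (hs.rpow_const fun σ => Or.inl (hpos σ).ne').inv₀ fun σ => (Real.rpow_pos_of_pos (hpos σ) _).ne'
  exact hk.smul ((crossCLM φ).continuous.comp (hXc.sub continuous_const))

/-- Continuity of the adjoint kernel `G′` (constant core `a₀ > 0`). [folklore] -/
theorem continuous_kernelCrossDeriv {X : ℝ → EuclideanSpace ℝ (Fin 3)} (hX : ContDiff ℝ 1 X) (p φ : EuclideanSpace ℝ (Fin 3))
    {a₀ : ℝ} (ha₀ : 0 < a₀) :
    Continuous fun σ => (3 * ⟪p - X σ, deriv X σ⟫ * ((‖p - X σ‖ ^ 2 + a₀) ^ (5 / 2 : ℝ))⁻¹) • cross φ (X σ - p)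
        + ((‖p - X σ‖ ^ 2 + a₀) ^ (3 / 2 : ℝ))⁻¹ • cross φ (deriv X σ) := by
  have hXc : Continuous X := hX.continuous
  have hX'c : Continuous (deriv X) := hX.continuous_deriv le_rfl
  have hs : Continuous fun σ => ‖p - X σ‖ ^ 2 + a₀ := ((continuous_const.sub hXc).norm.pow 2).add continuous_const
  have hpos : ∀ σ, 0 < ‖p - X σ‖ ^ 2 + a₀ := fun σ => by positivity
  have hk3 : Continuous fun σ => ((‖p - X σ‖ ^ 2 + a₀) ^ (3 / 2 : ℝ))⁻¹ :=
    (hs.rpow_const fun σ => Or.inl (hpos σ).ne').inv₀ fun σ => (Real.rpow_pos_of_pos (hpos σ) _).ne'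
  have hk5 : Continuous fun σ => ((‖p - X σ‖ ^ 2 + a₀) ^ (5 / 2 : ℝ))⁻¹ :=
    (hs.rpow_const fun σ => Or.inl (hpos σ).ne').inv₀ fun σ => (Real.rpow_pos_of_pos (hpos σ) _).ne'
  have hi : Continuous fun σ => ⟪p - X σ, deriv X σ⟫ := (continuous_const.sub hXc).inner hX'c
  have hc1 : Continuous fun σ => cross φ (X σ - p) := (crossCLM φ).continuous.comp (hXc.sub continuous_const)
  have hc2 : Continuous fun σ => cross φ (deriv X σ) := (crossCLM φ).continuous.comp hX'c
  exact (((continuous_const.mul hi).mul hk5).smul hc1).add (hk3.smul hc2)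

/-- **THE BIOT–SAVART `Y′`-TERM BY PARTS IN `σ`.**  Fixed station `p` and weight vector `φ`, a `C¹` axis `X`, a continuous positive core `a`
equal to `a₀ > 0` on an open `U ⊇ tsupport Y`, and a compactly supported `C¹` test field `Y`:
`∫ ⟪φ, ((‖p − Xσ‖² + aσ)^{3/2})⁻¹ • (Y′σ × (p − Xσ))⟫ dσ = −∫ ⟪G′σ, Yσ⟫ dσ`,
`G′σ = (3⟪p − Xσ, X′σ⟫((‖p − Xσ‖² + a₀)^{5/2})⁻¹) • (φ × (Xσ − p)) + ((‖p − Xσ‖² + a₀)^{3/2})⁻¹ • (φ × X′σ)`. [folklore] -/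
theorem integral_inner_kernel_cross_deriv_eq_neg {X Y : ℝ → EuclideanSpace ℝ (Fin 3)} (hX : ContDiff ℝ 1 X) (p φ : EuclideanSpace ℝ (Fin 3))
    {a : ℝ → ℝ} (hac : Continuous a) (hapos : ∀ σ, 0 < a σ) {a₀ : ℝ} (ha₀ : 0 < a₀) {U : Set ℝ} (hU : IsOpen U)
    (haU : ∀ σ ∈ U, a σ = a₀) (hY : ContDiff ℝ 1 Y) (hYc : HasCompactSupport Y) (hYU : tsupport Y ⊆ U) :
    ∫ σ, ⟪φ, ((‖p - X σ‖ ^ 2 + a σ) ^ (3 / 2 : ℝ))⁻¹ • cross (deriv Y σ) (p - X σ)⟫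
      = - ∫ σ, ⟪(3 * ⟪p - X σ, deriv X σ⟫ * ((‖p - X σ‖ ^ 2 + a₀) ^ (5 / 2 : ℝ))⁻¹) • cross φ (X σ - p)
          + ((‖p - X σ‖ ^ 2 + a₀) ^ (3 / 2 : ℝ))⁻¹ • cross φ (deriv X σ), Y σ⟫ := by
  have hptw : (fun σ => ⟪φ, ((‖p - X σ‖ ^ 2 + a σ) ^ (3 / 2 : ℝ))⁻¹ • cross (deriv Y σ) (p - X σ)⟫)
      = fun σ => ⟪((‖p - X σ‖ ^ 2 + a σ) ^ (3 / 2 : ℝ))⁻¹ • cross φ (X σ - p), deriv Y σ⟫ := by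
    funext σ; exact inner_smul_cross_sub_comm φ (deriv Y σ) p (X σ) _
  rw [hptw]
  exact integral_inner_deriv_eq_neg_of_support (continuous_kernelCross hX p φ hac hapos)
    (continuous_kernelCrossDeriv hX p φ ha₀) (fun σ hσ => hasDerivAt_kernelCross_of_mem hX p φ ha₀ hU haU (hYU hσ)) hY hYc

end Summit.NavierStokesRegularity.NavierStokesRegularity.Theorems.Clause13RNonlocalAdjoint

end
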